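import Summits.AtomisticToContinuum.Crystallization.Theorems.FrustratedLawDichotomyCappedRigidityCertPatterns

/-!
# FrustratedLawDichotomy · crux `AperiodicFrustratedLawGap` (stmt-AtomisticToContinuum-27623) — THE ℚ-MIRROR OF `G`:
# `LinkClassification θ ⟸ LinkCert θ`, a FINITE statement about 12 points of `ℝ³` and a 4-regular graph on `Fin 12`
# (decomp-a2c, prover hand 2, gen 9; lens-5 g29 NODE §3 «G = certified-finite-check class»)

`G = LinkClassification θ` (lens-5 g29, p820342): at every charge-free(θ) site of an injective configuration the θ-bond graph induced on the
twelve bonded neighbours is isomorphic, via a bijection from the fcc or the hcp kissing pattern, to that pattern's contact graph.  Lens-5's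
evidence (NODE-g29 §3) is a FINITE argument: angle windows at `θ = 1/100`, planarity, 4-regularity, the 13 classes of connected 4-regular
plane maps on 12 vertices, corner rules, antiprism exclusion.  This file types the finite statement that argument proves and reduces `G`
to it, for every `θ`:

`LinkCert θ` := for all `p : Fin 12 → ℝ³` and all graphs `B` on `Fin 12` (the centre is `0`, the unit is `nn_i = 1`):
1. radial window `1 ≤ ‖p u‖ ≤ 1 + θ`;  `p` injective;
2. nd-coupling `‖p u‖ ≤ (1+θ)·‖p u − x‖` for every `x ∈ {0} ∪ range p`, `x ≠ p u`;
3. `B`-bonds are coupled bonds: `B.Adj u v ⇒ ‖p u − p v‖ ≤ (1+θ)·‖p u − x‖` for every `x ∈ {0} ∪ range p`, `x ≠ p u`;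
4. `B`-non-bonds are non-bonds: `u ≠ v`, `¬B.Adj u v ⇒ min ‖p u‖ ‖p v‖ < ‖p u − p v‖`;
5. `B` is 4-regular: `#{v | B.Adj u v} = 4` for every `u` (the ring numbers of a charge-free site);
THEN `B` is, via a bijection `τ₀ : Pat → Fin 12`, the contact graph of `Pat = fcc` or `Pat = hcp` (`B.Adj (τ₀ u) (τ₀ v) ↔ dist u v = 1`).

* `linkClassification_of_linkCert : LinkCert θ → LinkClassification θ` — enumerate the 12 neighbours of a charge-free site, rescale by
  `nn_i⁻¹`, read clauses 1–4 off `bondGraph_adj` / `nearestDist_le_dist` and clause 5 off the ring numbers, apply the certificate, compose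
  the bijection with the enumeration.
* by name: `kr2Shape_of_linkCert` (`LinkCert(1/100) ∧ P ∧ CappedCert fcc ∧ CappedCert hcp ⟹ KR2Shape` — the geometric side of the
  dichotomy column as TWO FINITE CERTIFICATES plus the bridge P), `aperiodicFrustratedLawGap_of_linkCert`, `noFrustratedPeriodicMinimiser_of_linkCert`.
NOT in the hypothesis set (not derivable from `IsChargeFree` alone): anything about sites not bonded to the centre; the `7/10` hard core
(absolute scale).  `[folklore]` bookkeeping; no `sorry`; no `instance`/`notation`.
-/

noncomputable section

namespace Summit.AtomisticToContinuum.Crystallization.Theorems.FrustratedLawDichotomyLinkCert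

open Literature.Geometry.DiscreteGeometry
open Summit.AtomisticToContinuum.Crystallization.Theses.PricedLinkCensus (ChargedEnergyGap)
open Summit.AtomisticToContinuum.Crystallization.Theorems.FrustratedLawDichotomyTwoShellRigidityCut
  (E3 LinkIso LinkClassification CapForcing KR2Shape kr2Shape_of_cut aperiodicFrustratedLawGap_of_cut
    noFrustratedPeriodicMinimiser_of_cut)
open Summit.AtomisticToContinuum.Crystallization.Theorems.FrustratedLawDichotomyCappedRigidityCert (CappedCert)
open Summit.AtomisticToContinuum.Crystallization.Theorems.FrustratedLawDichotomyCappedRigidityCertPatterns (cappedRigidity_of_cert)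

/-- **`LinkCert θ` — the ℚ-mirror of `G = LinkClassification θ`** (finite: 12 points, a 4-regular graph on `Fin 12`, the nd-coupled windows;
see the module docstring).  [GLOBAL · certificate / finite-check target; lens-5 g29 NODE §3: 13 map classes → cubocta, anticubocta,
hexagonal antiprism → antiprism infeasible (margin 5.46°) at `θ = 1/100`] -/
def LinkCert (θ : ℝ) : Prop :=
  ∀ (p : Fin 12 → E3) (B : SimpleGraph (Fin 12)),
    (∀ u, 1 ≤ ‖p u‖ ∧ ‖p u‖ ≤ 1 + θ) →
    Function.Injective p →
    (∀ u, ∀ x ∈ insert (0 : E3) (Set.range p), x ≠ p u → ‖p u‖ ≤ (1 + θ) * ‖p u - x‖) →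
    (∀ u v, B.Adj u v → ∀ x ∈ insert (0 : E3) (Set.range p), x ≠ p u → ‖p u - p v‖ ≤ (1 + θ) * ‖p u - x‖) →
    (∀ u v, u ≠ v → ¬ B.Adj u v → min ‖p u‖ ‖p v‖ < ‖p u - p v‖) →
    (∀ u, ({v | B.Adj u v} : Set (Fin 12)).ncard = 4) →
      (∃ τ₀ : ↥fccKissingPattern → Fin 12, Function.Bijective τ₀ ∧
          ∀ u v : ↥fccKissingPattern, B.Adj (τ₀ u) (τ₀ v) ↔ dist (u : E3) (v : E3) = 1) ∨
        (∃ τ₀ : ↥hcpKissingPattern → Fin 12, Function.Bijective τ₀ ∧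
          ∀ u v : ↥hcpKissingPattern, B.Adj (τ₀ u) (τ₀ v) ↔ dist (u : E3) (v : E3) = 1)

/-- **THE REDUCTION `LinkCert θ → LinkClassification θ`** (every `θ`). [folklore] -/
theorem linkClassification_of_linkCert {θ : ℝ} (hcert : LinkCert θ) : LinkClassification θ := by
  classical
  intro N y hy _hsep i hcf
  have hadj : ∀ {j k : Fin N}, (bondGraph θ y).Adj j k ↔
      j ≠ k ∧ dist (y j) (y k) ≤ (1 + θ) * min (nearestDist y j) (nearestDist y k) :=
    fun {j k} => bondGraph_adj
  -- enumerate the twelve neighbours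
  set Nb : Set (Fin N) := (bondGraph θ y).neighborSet i with hNb_def
  haveI : Fintype ↥Nb := Fintype.ofFinite _
  have hcard : Fintype.card ↥Nb = Fintype.card (Fin 12) := by
    rw [← Nat.card_eq_fintype_card, Nat.card_coe_set_eq, hcf.1, Fintype.card_fin]
  obtain ⟨e⟩ := Fintype.card_eq.1 hcard
  set site : Fin 12 → Fin N := fun u => ((e.symm u : ↥Nb) : Fin N) with hsite_def
  have hsite_adj : ∀ u, (bondGraph θ y).Adj i (site u) := fun u => (e.symm u).2
  have hsite_inj : Function.Injective site := fun u v h => e.symm.injective (Subtype.ext h)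
  have hsite_surj : ∀ k, (bondGraph θ y).Adj i k → ∃ u, site u = k := fun k hk =>
    ⟨e ⟨k, hk⟩, by simp [hsite_def]⟩
  have hsite_ne : ∀ u, site u ≠ i := fun u h => (hsite_adj u).ne h.symm
  -- the unit `r = nn_i > 0`
  obtain ⟨k₀, hk₀, hr⟩ := exists_nearestDist_eq_dist y (j := i) ⟨site 0, hsite_ne 0⟩
  set r : ℝ := nearestDist y i with hr_def
  have hr0 : 0 < r := by
    rw [hr]
    exact dist_pos.2 fun h => hk₀ (hy h).symm
  have hri : 0 < r⁻¹ := inv_pos.2 hr0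
  have hθ : 0 ≤ 1 + θ := by
    by_contra hneg
    have hlt := not_le.1 hneg
    obtain ⟨hne, hle⟩ := hadj.1 (hsite_adj 0)
    have hpos : 0 < dist (y i) (y (site 0)) := dist_pos.2 fun h => hne (hy h)
    have hmin : 0 ≤ min (nearestDist y i) (nearestDist y (site 0)) :=
      le_min (nearestDist_nonneg _ _) (nearestDist_nonneg _ _)
    nlinarith
  -- the rescaled configuration
  set q : Fin N → E3 := fun j => r⁻¹ • (y j - y i) with hq_def
  have hq_sub : ∀ j l, ‖q j - q l‖ = r⁻¹ * dist (y j) (y l) := by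
    intro j l
    simp only [hq_def]
    rw [← smul_sub, sub_sub_sub_cancel_right, norm_smul, Real.norm_of_nonneg hri.le, dist_eq_norm]
  have hqi : q i = 0 := by simp [hq_def]
  have hq_norm : ∀ j, ‖q j‖ = r⁻¹ * dist (y j) (y i) := by
    intro j
    have := hq_sub j i
    rwa [hqi, sub_zero] at this
  have hq_inj : Function.Injective q := by
    intro j l h
    have h0 : ‖q j - q l‖ = 0 := by rw [h, sub_self, norm_zero]
    rw [hq_sub] at h0
    rcases mul_eq_zero.1 h0 with h1 | h1
    · exact absurd h1 hri.ne'
    · exact hy (dist_eq_zero.1 h1)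
  have factA : ∀ j, j ≠ i → 1 ≤ ‖q j‖ := by
    intro j hj
    rw [hq_norm, dist_comm]
    have := nearestDist_le_dist y hj
    rw [← hr_def] at this
    calc (1 : ℝ) = r⁻¹ * r := by field_simp
      _ ≤ r⁻¹ * dist (y i) (y j) := mul_le_mul_of_nonneg_left this hri.le
  have factR : ∀ j, (bondGraph θ y).Adj i j → ‖q j‖ ≤ 1 + θ := by
    intro j hj
    obtain ⟨-, hle⟩ := hadj.1 hj
    rw [hq_norm, dist_comm]
    have h1 : dist (y i) (y j) ≤ (1 + θ) * r :=
      hle.trans (mul_le_mul_of_nonneg_left (min_le_left _ _) hθ)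
    calc r⁻¹ * dist (y i) (y j) ≤ r⁻¹ * ((1 + θ) * r) := mul_le_mul_of_nonneg_left h1 hri.le
      _ = 1 + θ := by field_simp
  have factB : ∀ j k l, (bondGraph θ y).Adj j k → l ≠ j → ‖q j - q k‖ ≤ (1 + θ) * ‖q j - q l‖ := by
    intro j k l hjk hlj
    obtain ⟨-, hle⟩ := hadj.1 hjk
    have h1 : dist (y j) (y k) ≤ (1 + θ) * dist (y j) (y l) :=
      hle.trans ((mul_le_mul_of_nonneg_left (min_le_left _ _) hθ).trans
        (mul_le_mul_of_nonneg_left (nearestDist_le_dist y hlj) hθ))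
    rw [hq_sub, hq_sub]
    calc r⁻¹ * dist (y j) (y k) ≤ r⁻¹ * ((1 + θ) * dist (y j) (y l)) := mul_le_mul_of_nonneg_left h1 hri.le
      _ = (1 + θ) * (r⁻¹ * dist (y j) (y l)) := by ring
  have factC : ∀ j k, (bondGraph θ y).Adj i j → (bondGraph θ y).Adj i k → j ≠ k → ¬ (bondGraph θ y).Adj j k →
      min ‖q j‖ ‖q k‖ < ‖q j - q k‖ := by
    intro j k hij hik hjk hnot
    have hgt : (1 + θ) * min (nearestDist y j) (nearestDist y k) < dist (y j) (y k) := by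
      by_contra hle
      exact hnot (hadj.2 ⟨hjk, not_lt.1 hle⟩)
    obtain ⟨-, hj⟩ := hadj.1 hij
    obtain ⟨-, hk⟩ := hadj.1 hik
    have hj' : dist (y j) (y i) ≤ (1 + θ) * nearestDist y j := by
      rw [dist_comm]; exact hj.trans (mul_le_mul_of_nonneg_left (min_le_right _ _) hθ)
    have hk' : dist (y k) (y i) ≤ (1 + θ) * nearestDist y k := by
      rw [dist_comm]; exact hk.trans (mul_le_mul_of_nonneg_left (min_le_right _ _) hθ)
    have hmin : min (dist (y j) (y i)) (dist (y k) (y i)) < dist (y j) (y k) := by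
      rw [mul_min_of_nonneg _ _ hθ] at hgt
      exact lt_of_le_of_lt (min_le_min hj' hk') hgt
    rw [hq_norm, hq_norm, hq_sub, ← mul_min_of_nonneg _ _ hri.le]
    exact mul_lt_mul_of_pos_left hmin hri
  -- the finite data: shell and induced graph
  set p : Fin 12 → E3 := fun u => q (site u) with hp_def
  set B : SimpleGraph (Fin 12) := (bondGraph θ y).comap site with hB_def
  have hS' : ∀ {x} {j : Fin N}, x ∈ insert (0 : E3) (Set.range p) → x ≠ q j → ∃ l, l ≠ j ∧ q l = x := by
    intro x j hx hne
    rcases hx with rfl | ⟨u, rfl⟩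
    · exact ⟨i, fun h => hne (by rw [← h, hqi]), hqi⟩
    · exact ⟨site u, fun h => hne (by simp [hp_def, h]), rfl⟩
  -- ring numbers = degrees of the induced graph
  have hring : ∀ u, ({v | B.Adj u v} : Set (Fin 12)).ncard = 4 := by
    intro u
    have himg : site '' ({v | B.Adj u v} : Set (Fin 12)) =
        (bondGraph θ y).neighborSet i ∩ (bondGraph θ y).neighborSet (site u) := by
      ext k
      simp only [Set.mem_image, Set.mem_setOf_eq, Set.mem_inter_iff, SimpleGraph.mem_neighborSet, hB_def,
        SimpleGraph.comap_adj]
      constructor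
      · rintro ⟨v, hv, rfl⟩
        exact ⟨hsite_adj v, hv⟩
      · rintro ⟨hik, huk⟩
        obtain ⟨v, rfl⟩ := hsite_surj k hik
        exact ⟨v, huk, rfl⟩
    rw [← Set.ncard_image_of_injective _ hsite_inj, himg]
    exact hcf.2 (site u) (hsite_adj u)
  -- apply the certificate
  have hmain := hcert p B
    (fun u => ⟨factA _ (hsite_ne u), factR _ (hsite_adj u)⟩)
    (hq_inj.comp hsite_inj)
    (by
      intro u x hx hne
      obtain ⟨l, hl, rfl⟩ := hS' hx hne
      have := factB (site u) i l (hsite_adj u).symm hl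
      rwa [hqi, sub_zero] at this)
    (by
      intro u v huv x hx hne
      obtain ⟨l, hl, rfl⟩ := hS' hx hne
      exact factB (site u) (site v) l (SimpleGraph.comap_adj.1 huv) hl)
    (by
      intro u v huv hnot
      exact factC (site u) (site v) (hsite_adj u) (hsite_adj v) (hsite_inj.ne huv)
        (fun h => hnot (SimpleGraph.comap_adj.2 h)))
    hring
  -- compose the bijection with the enumeration
  rcases hmain with ⟨τ₀, hbij, hiso⟩ | ⟨τ₀, hbij, hiso⟩
  · refine Or.inl ⟨site ∘ τ₀, fun u => hsite_adj (τ₀ u), fun k hk => ?_, fun u v => ?_⟩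
    · obtain ⟨w, hw⟩ := hsite_surj k hk
      obtain ⟨u, hu⟩ := hbij.2 w
      exact ⟨u, by simp [Function.comp, hu, hw]⟩
    · exact Iff.trans Iff.rfl (hiso u v)
  · refine Or.inr ⟨site ∘ τ₀, fun u => hsite_adj (τ₀ u), fun k hk => ?_, fun u v => ?_⟩
    · obtain ⟨w, hw⟩ := hsite_surj k hk
      obtain ⟨u, hu⟩ := hbij.2 w
      exact ⟨u, by simp [Function.comp, hu, hw]⟩
    · exact Iff.trans Iff.rfl (hiso u v)

/-- **The geometric side of the dichotomy column as TWO FINITE CERTIFICATES plus the bridge P**: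
`LinkCert(1/100) ∧ CapForcing(1/100) ∧ CappedCert(1/100, 1/20, fcc) ∧ CappedCert(1/100, 1/20, hcp) ⟹ KR2Shape`. [folklore] -/
theorem kr2Shape_of_linkCert (hG : LinkCert (1 / 100)) (hP : CapForcing (1 / 100))
    (hf : CappedCert (1 / 100) (1 / 20) fccKissingPattern) (hh : CappedCert (1 / 100) (1 / 20) hcpKissingPattern) : KR2Shape :=
  kr2Shape_of_cut (linkClassification_of_linkCert hG) hP (cappedRigidity_of_cert hf hh)

/-- **`AperiodicFrustratedLawGap` (crux of item 27623) BY NAME** from `MuEquilibriumDoor ∧ ChargedEnergyGap ∧ LinkCert ∧ CapForcing ∧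
CappedCert fcc ∧ CappedCert hcp` at the literals. [folklore] -/
theorem aperiodicFrustratedLawGap_of_linkCert
    (hDoor : Summit.AtomisticToContinuum.Crystallization.Theses.GrainCoreNetworkSplit.MuEquilibriumDoor) (hgap : ChargedEnergyGap)
    (hG : LinkCert (1 / 100)) (hP : CapForcing (1 / 100))
    (hf : CappedCert (1 / 100) (1 / 20) fccKissingPattern) (hh : CappedCert (1 / 100) (1 / 20) hcpKissingPattern) :
    Summit.AtomisticToContinuum.Crystallization.Theses.FrustratedLawDichotomy.AperiodicFrustratedLawGap :=
  aperiodicFrustratedLawGap_of_cut hDoor hgap (linkClassification_of_linkCert hG) hP (cappedRigidity_of_cert hf hh)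

/-- **Item 26654 `NoFrustratedPeriodicMinimiser`, door-free**, from `ChargedEnergyGap ∧ LinkCert ∧ CapForcing ∧ CappedCert fcc ∧ CappedCert hcp`.
[folklore] -/
theorem noFrustratedPeriodicMinimiser_of_linkCert (hgap : ChargedEnergyGap)
    (hG : LinkCert (1 / 100)) (hP : CapForcing (1 / 100))
    (hf : CappedCert (1 / 100) (1 / 20) fccKissingPattern) (hh : CappedCert (1 / 100) (1 / 20) hcpKissingPattern) :
    Summit.AtomisticToContinuum.Crystallization.Theses.PeriodicChargeSplit.NoFrustratedPeriodicMinimiser :=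
  noFrustratedPeriodicMinimiser_of_cut hgap (linkClassification_of_linkCert hG) hP (cappedRigidity_of_cert hf hh)

end Summit.AtomisticToContinuum.Crystallization.Theorems.FrustratedLawDichotomyLinkCert

end
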